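import Literature.Computability.AlgebraicComplexity.AsymmetricHashing
import Literature.Computability.AlgebraicComplexity.LaserMethodTypes
import HarnessLib

/-!
# Asymmetric cleanup of the buckets: survival of a block triple and the expected number of
surviving triples (Vassilevska Williams–Xu–Xu–Zhou 2024, §5.2, Claims 5.6 and 5.7) — proved

Topic `Literature/Computability/AlgebraicComplexity`.  After hashing (`AsymmetricHashing.lean`), §5.2
of Vassilevska Williams–Xu–Xu–Zhou, *New bounds for matrix multiplication: from alpha to omega*
(SODA 2024, arXiv:2307.07970) cleans the buckets ASYMMETRICALLY:

> For every bucket `b`, if it contains two level-`ℓ` triples `X_I Y_J Z_K` and `X_I Y_{J'} Z_{K'}`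
> that share the same `X`-block, then we zero out `X_I`. Similarly … `Y_J`. … each level-`ℓ` block
> `X_I` or `Y_J` is in a unique level-`ℓ` block triple. For every level-`ℓ` block `X_I` (or `Y_J`),
> we check whether the unique triple containing it is consistent with `α`; if not, we zero out `X_I`
> (or `Y_J`). We call the tensor after this step `𝒯'`.
>
> **Claim 5.6.** For every `b ∈ B` and every level-`ℓ` block triple `X_I Y_J Z_K ∈ 𝒯` that is
> consistent with `α`, the probability that `X_I Y_J Z_K` remains in `𝒯'` conditioned on
> `h_X(I) = h_Y(J) = h_Z(K) = b` is `≥ 3/4`.  [Proof: by symmetry each `X`-block is in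
> `numtriple/numxblock` triples; each collides with probability `1/M` (Claim 5.5); union bound with
> `M₀ ≥ 8 · max{numtriple/numxblock, numtriple/numyblock}`.]
>
> **Claim 5.7.** The expected number of level-`ℓ` block triples in `𝒯'` is at least
> `numalpha · |B| · (3/4) · (1/M²) = numalpha · M₀^{-1-o(1)}`.

Here `𝒯` = the block triples remaining after the zero-out by the marginals `α_X, α_Y, α_Z` = the
tree's typed support `typedSupport (levelSupport P) n μX μY μZ` (`LaserMethodTypes.lean`: triples of
words of types `μX, μY, μZ` over `{0,…,P}`, `P = 2^ℓ`, with `I_t + J_t + K_t = P` at every position;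
`numtriple = |𝒯|`, `numxblock = |typeClass n μX|`).  This file PROVES, as exact counting statements
over the seed space `Ω = VxxzSeed M n` (`|Ω| = M^{n+2}`):

* `Survives 𝒯 ω T b` — the triple `T = (I,J,K)` lies in bucket `b` and no OTHER triple of `𝒯` sharing
  `X_I` or sharing `Y_J` lies in bucket `b`: exactly the condition for `T` (consistent with `α`) to
  remain in `𝒯'`;
* `vxxz2024_claim56` — **Claim 5.6**: if `8 |𝒯| ≤ M |typeClass n μX|` and `8 |𝒯| ≤ M |typeClass n μY|`
  (the printed `M ≥ M₀ ≥ 8 max{numtriple/numxblock, numtriple/numyblock}`), `M` an odd prime `> P`,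
  `n ≥ 1`, then `4 · #{ω | Survives 𝒯 ω T b} ≥ 3 · M^n = 3 · #{ω | T in bucket b}`, for EVERY `T ∈ 𝒯`
  and every `b` (the symmetric degree `numtriple/numxblock` is `card_typedSupport_eq_mul_fibre₁`;
  the collision counts are `card_seeds_vxxzHash_bucket_shareX/Y`);
* `vxxz2024_claim57` — **Claim 5.7** summed over any set `𝒯α ⊆ 𝒯` (the triples consistent with `α`)
  and over the Salem–Spencer set `B`:
  `4 · ∑_ω #{(b,T) ∈ B × 𝒯α | Survives ω T b} ≥ 3 |B| |𝒯α| M^n`, i.e. the expectation is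
  `≥ (3/4) |B| |𝒯α| / M²`; and `vxxz2024_claim57_exists` — some seed attains it:
  `∃ ω, 4 M² · #{T ∈ 𝒯α surviving in some bucket of B} ≥ 3 |B| |𝒯α|`.

Everything is proved; two definitions (`levelSupport`, the predicates `InBucket`/`Survives`);
no named facts.

## References

* V. Vassilevska Williams, Y. Xu, Z. Xu, R. Zhou, *New bounds for matrix multiplication: from alpha
  to omega*, SODA 2024, arXiv:2307.07970 (held: `paper:arxiv-2307.07970`), §5.2: the cleanup, the
  requirement (M₀ bound), Claims 5.5–5.7 and their proofs. [VassilevskaWilliamsXuXuZhou2024]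
-/

open scoped BigOperators
open Finset

namespace Literature.Computability.AlgebraicComplexity

/-! ## The set `𝒯` of block triples with prescribed marginal types -/

section TripleSet

variable {n P : ℕ}

/-- The level support `{(i,j,k) ∈ {0,…,P}³ | i + j + k = P}` (`P = 2^ℓ`): the triples of level-`ℓ`
block indices on which the power is supported. [cite: VassilevskaWilliamsXuXuZhou2024, §3.8 and §5.2 ("X_t + Y_t + Z_t = 2^ℓ for every t")] -/
def levelSupport (P : ℕ) : Finset (Fin (P + 1) × Fin (P + 1) × Fin (P + 1)) :=
  univ.filter fun s => (s.1 : ℕ) + s.2.1 + s.2.2 = P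

/-- Membership in the level support. [cite: VassilevskaWilliamsXuXuZhou2024, §3.8] -/
@[simp] theorem mem_levelSupport {s : Fin (P + 1) × Fin (P + 1) × Fin (P + 1)} :
    s ∈ levelSupport P ↔ (s.1 : ℕ) + s.2.1 + s.2.2 = P := by
  simp [levelSupport]

/-- A level-`ℓ` index sequence read in `ℕ`. [folklore] -/
abbrev seqVal (I : Fin n → Fin (P + 1)) : Fin n → ℕ := fun t => (I t : ℕ)

/-- Entries are `< M` once `P < M`. [cite: VassilevskaWilliamsXuXuZhou2024, §5.2 (M ≥ M₀)] -/
theorem seqVal_lt {M : ℕ} (hPM : P < M) (I : Fin n → Fin (P + 1)) (t : Fin n) : seqVal I t < M :=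
  lt_of_lt_of_le (Nat.lt_succ_iff.2 (Nat.le_of_lt_succ (I t).isLt)) hPM

/-- In `𝒯`, the level sums are `P` at every position. [cite: VassilevskaWilliamsXuXuZhou2024, §5.2] -/
theorem levelSum_of_mem_typedSupport {μX μY μZ : Fin (P + 1) → ℕ}
    {T : (Fin n → Fin (P + 1)) × (Fin n → Fin (P + 1)) × (Fin n → Fin (P + 1))}
    (hT : T ∈ typedSupport (levelSupport P) n μX μY μZ) (t : Fin n) :
    seqVal T.1 t + seqVal T.2.1 t + seqVal T.2.2 t = P := by
  have := (mem_typedSupport.1 hT).2.2.2 t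
  simpa using this

/-- Two different triples of `𝒯` sharing the `X`-block have different `Y`-blocks. [cite: VassilevskaWilliamsXuXuZhou2024, Claim 5.5 ("two different block triples X_I Y_J Z_K, X_I Y_{J'} Z_{K'}")] -/
theorem snd_ne_of_fst_eq {μX μY μZ : Fin (P + 1) → ℕ}
    {T T' : (Fin n → Fin (P + 1)) × (Fin n → Fin (P + 1)) × (Fin n → Fin (P + 1))}
    (hT : T ∈ typedSupport (levelSupport P) n μX μY μZ) (hT' : T' ∈ typedSupport (levelSupport P) n μX μY μZ)
    (hne : T' ≠ T) (h1 : T'.1 = T.1) : seqVal T'.2.1 ≠ seqVal T.2.1 := by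
  intro h2
  apply hne
  have hJ : T'.2.1 = T.2.1 := funext fun t => Fin.ext (congrFun h2 t)
  have hK : T'.2.2 = T.2.2 := by
    funext t
    apply Fin.ext
    have a := levelSum_of_mem_typedSupport hT t
    have a' := levelSum_of_mem_typedSupport hT' t
    rw [h1, hJ] at a'
    simp only [seqVal] at a a'
    omega
  exact Prod.ext h1 (Prod.ext hJ hK)

/-- Two different triples of `𝒯` sharing the `Y`-block have different `X`-blocks. [cite: VassilevskaWilliamsXuXuZhou2024, Claim 5.5] -/
theorem fst_ne_of_snd_eq {μX μY μZ : Fin (P + 1) → ℕ}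
    {T T' : (Fin n → Fin (P + 1)) × (Fin n → Fin (P + 1)) × (Fin n → Fin (P + 1))}
    (hT : T ∈ typedSupport (levelSupport P) n μX μY μZ) (hT' : T' ∈ typedSupport (levelSupport P) n μX μY μZ)
    (hne : T' ≠ T) (h2 : T'.2.1 = T.2.1) : seqVal T'.1 ≠ seqVal T.1 := by
  intro h1
  apply hne
  have hI : T'.1 = T.1 := funext fun t => Fin.ext (congrFun h1 t)
  have hK : T'.2.2 = T.2.2 := by
    funext t
    apply Fin.ext
    have a := levelSum_of_mem_typedSupport hT t
    have a' := levelSum_of_mem_typedSupport hT' t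
    rw [hI, h2] at a'
    simp only [seqVal] at a a'
    omega
  exact Prod.ext hI (Prod.ext h2 hK)

end TripleSet

/-! ## Buckets and survival of a triple under the asymmetric cleanup -/

section Survival

variable {M : ℕ} {n P : ℕ}

/-- **"The triple `X_I Y_J Z_K` is contained in bucket `b`"**: `h_X(I) = h_Y(J) = h_Z(K) = b`.
[cite: VassilevskaWilliamsXuXuZhou2024, §5.2 (buckets)] -/
def InBucket (P : ℕ) (ω : VxxzSeed M n)
    (T : (Fin n → Fin (P + 1)) × (Fin n → Fin (P + 1)) × (Fin n → Fin (P + 1))) (b : ZMod M) : Prop :=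
  vxxzHashX ω (seqVal T.1) = b ∧ vxxzHashY ω (seqVal T.2.1) = b ∧ vxxzHashZ P ω (seqVal T.2.2) = b

/-- Being in a bucket is decidable (equalities in `ℤ/M`). [folklore] -/
instance InBucket.decidable (P : ℕ) (ω : VxxzSeed M n)
    (T : (Fin n → Fin (P + 1)) × (Fin n → Fin (P + 1)) × (Fin n → Fin (P + 1))) (b : ZMod M) :
    Decidable (InBucket P ω T b) := by
  unfold InBucket; infer_instance

/-- **Survival of `T` in bucket `b` under the asymmetric cleanup**: `T` lies in bucket `b`, and no
OTHER triple of `𝒯` sharing its `X`-block, and no other triple sharing its `Y`-block, lies in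
bucket `b` (then `X_I` and `Y_J` are in a unique triple of their bucket and are kept; for `T`
consistent with `α` the subsequent check keeps it too: `T ∈ 𝒯'`).
[cite: VassilevskaWilliamsXuXuZhou2024, §5.2 (the cleanup) and Claim 5.6 (proof: "the only way that X_I Y_J Z_K does not remain …")] -/
def Survives (𝒯 : Finset ((Fin n → Fin (P + 1)) × (Fin n → Fin (P + 1)) × (Fin n → Fin (P + 1))))
    (ω : VxxzSeed M n) (T : (Fin n → Fin (P + 1)) × (Fin n → Fin (P + 1)) × (Fin n → Fin (P + 1)))
    (b : ZMod M) : Prop :=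
  InBucket P ω T b ∧ (∀ T' ∈ 𝒯, T' ≠ T → T'.1 = T.1 → ¬ InBucket P ω T' b) ∧
    (∀ T' ∈ 𝒯, T' ≠ T → T'.2.1 = T.2.1 → ¬ InBucket P ω T' b)

/-- Survival is decidable (classically; only counts of survivors are used). [folklore] -/
noncomputable instance Survives.decidable
    (𝒯 : Finset ((Fin n → Fin (P + 1)) × (Fin n → Fin (P + 1)) × (Fin n → Fin (P + 1))))
    (ω : VxxzSeed M n) (T : (Fin n → Fin (P + 1)) × (Fin n → Fin (P + 1)) × (Fin n → Fin (P + 1)))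
    (b : ZMod M) : Decidable (Survives 𝒯 ω T b) := Classical.dec _

/-- A triple survives in at most one bucket (its bucket is `h_X(I)`), so for a fixed seed the number
of pairs `(b, T)`, `b ∈ B`, with `T` surviving in bucket `b` is the number of triples surviving in
SOME bucket of `B`. [cite: VassilevskaWilliamsXuXuZhou2024, §5.2] -/
theorem card_filter_product_survives_eq
    (𝒯 𝒯α : Finset ((Fin n → Fin (P + 1)) × (Fin n → Fin (P + 1)) × (Fin n → Fin (P + 1))))
    (B : Finset (ZMod M)) (ω : VxxzSeed M n) :
    ((B ×ˢ 𝒯α).filter fun bT => Survives 𝒯 ω bT.2 bT.1).card =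
      (𝒯α.filter fun T => ∃ b ∈ B, Survives 𝒯 ω T b).card := by
  classical
  refine card_bij (fun bT _ => bT.2) (fun bT hbT => ?_) (fun bT₁ h₁ bT₂ h₂ h => ?_) (fun T hT => ?_)
  · rw [mem_filter, mem_product] at hbT
    exact mem_filter.2 ⟨hbT.1.2, bT.1, hbT.1.1, hbT.2⟩
  · rw [mem_filter] at h₁ h₂
    have hb : bT₁.1 = bT₂.1 := by
      have e1 := h₁.2.1.1
      have e2 := h₂.2.1.1
      rw [h] at e1
      exact e1.symm.trans e2
    exact Prod.ext hb h
  · rw [mem_filter] at hT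
    obtain ⟨hT, b, hb, hs⟩ := hT
    exact ⟨(b, T), mem_filter.2 ⟨mem_product.2 ⟨hb, hT⟩, hs⟩, rfl⟩

variable [Fact M.Prime]

/-- The number of seeds putting a triple of `𝒯` into bucket `b` is `M^n` (Claim 5.5, first part).
[cite: VassilevskaWilliamsXuXuZhou2024, Claim 5.5] -/
theorem card_seeds_inBucket (hM : M ≠ 2) {μX μY μZ : Fin (P + 1) → ℕ}
    {T : (Fin n → Fin (P + 1)) × (Fin n → Fin (P + 1)) × (Fin n → Fin (P + 1))}
    (hT : T ∈ typedSupport (levelSupport P) n μX μY μZ) (b : ZMod M) :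
    (univ.filter fun ω : VxxzSeed M n => InBucket P ω T b).card = M ^ n := by
  have h := card_seeds_vxxzHash_bucket (n := n) hM (levelSum_of_mem_typedSupport hT) b
  have hM2 : 0 < M ^ 2 := pow_pos (Nat.Prime.pos Fact.out) 2
  refine Nat.eq_of_mul_eq_mul_right hM2 ?_
  rw [show M ^ n * M ^ 2 = M ^ (n + 2) by ring, ← h]
  rfl

/-- The number of seeds putting BOTH `T` and another triple `T'` of `𝒯` sharing `X_I` into bucket `b`
is `M^{n-1}` (Claim 5.5, second part). [cite: VassilevskaWilliamsXuXuZhou2024, Claim 5.5] -/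
theorem card_seeds_inBucket_shareX (hM : M ≠ 2) (hPM : P < M) (hn : 0 < n) {μX μY μZ : Fin (P + 1) → ℕ}
    {T T' : (Fin n → Fin (P + 1)) × (Fin n → Fin (P + 1)) × (Fin n → Fin (P + 1))}
    (hT : T ∈ typedSupport (levelSupport P) n μX μY μZ) (hT' : T' ∈ typedSupport (levelSupport P) n μX μY μZ)
    (hne : T' ≠ T) (h1 : T'.1 = T.1) (b : ZMod M) :
    (univ.filter fun ω : VxxzSeed M n => InBucket P ω T b ∧ InBucket P ω T' b).card = M ^ (n - 1) := by
  have hJ := snd_ne_of_fst_eq hT hT' hne h1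
  have h := card_seeds_vxxzHash_bucket_shareX (n := n) hM (levelSum_of_mem_typedSupport hT)
    (I := seqVal T.1) (J' := seqVal T'.2.1) (K' := seqVal T'.2.2)
    (by intro t; have := levelSum_of_mem_typedSupport hT' t; rw [h1] at this; exact this)
    (seqVal_lt hPM _) (seqVal_lt hPM _) hJ.symm b
  have hM3 : 0 < M ^ 3 := pow_pos (Nat.Prime.pos Fact.out) 3
  refine Nat.eq_of_mul_eq_mul_right hM3 ?_
  have hn' : n - 1 + 3 = n + 2 := by omega
  rw [← pow_add, hn', ← h]
  congr 2
  refine Finset.filter_congr fun ω _ => ?_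
  simp only [InBucket, h1]

/-- The same for another triple sharing `Y_J`. [cite: VassilevskaWilliamsXuXuZhou2024, Claim 5.5] -/
theorem card_seeds_inBucket_shareY (hM : M ≠ 2) (hPM : P < M) (hn : 0 < n) {μX μY μZ : Fin (P + 1) → ℕ}
    {T T' : (Fin n → Fin (P + 1)) × (Fin n → Fin (P + 1)) × (Fin n → Fin (P + 1))}
    (hT : T ∈ typedSupport (levelSupport P) n μX μY μZ) (hT' : T' ∈ typedSupport (levelSupport P) n μX μY μZ)
    (hne : T' ≠ T) (h2 : T'.2.1 = T.2.1) (b : ZMod M) :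
    (univ.filter fun ω : VxxzSeed M n => InBucket P ω T b ∧ InBucket P ω T' b).card = M ^ (n - 1) := by
  have hI := fst_ne_of_snd_eq hT hT' hne h2
  have h := card_seeds_vxxzHash_bucket_shareY (n := n) hM (levelSum_of_mem_typedSupport hT)
    (J := seqVal T.2.1) (I' := seqVal T'.1) (K' := seqVal T'.2.2)
    (by intro t; have := levelSum_of_mem_typedSupport hT' t; rw [h2] at this; exact this)
    (seqVal_lt hPM _) (seqVal_lt hPM _) hI.symm b
  have hM3 : 0 < M ^ 3 := pow_pos (Nat.Prime.pos Fact.out) 3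
  refine Nat.eq_of_mul_eq_mul_right hM3 ?_
  have hn' : n - 1 + 3 = n + 2 := by omega
  rw [← pow_add, hn', ← h]
  congr 2
  refine Finset.filter_congr fun ω _ => ?_
  simp only [InBucket, h2]

/-- **The symmetric degree** ("By symmetry, each `X`-block is in the same number of block triples,
which is `numtriple/numxblock`"): `#{T' ∈ 𝒯 | T'.1 = I} · |typeClass n μX| = |𝒯|` for `I` of type
`μX`. [cite: VassilevskaWilliamsXuXuZhou2024, Claim 5.6 (proof)] -/
theorem degX_mul_card_typeClass {μX μY μZ : Fin (P + 1) → ℕ} {I : Fin n → Fin (P + 1)}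
    (hI : letterCount I = μX) :
    ((typedSupport (levelSupport P) n μX μY μZ).filter fun T' => T'.1 = I).card * (typeClass n μX).card =
      (typedSupport (levelSupport P) n μX μY μZ).card := by
  rw [card_typedSupport_eq_mul_fibre₁ (levelSupport P) μX μY μZ hI, mul_comm]

/-- The symmetric degree in `Y`. [cite: VassilevskaWilliamsXuXuZhou2024, Claim 5.6 (proof)] -/
theorem degY_mul_card_typeClass {μX μY μZ : Fin (P + 1) → ℕ} {J : Fin n → Fin (P + 1)}
    (hJ : letterCount J = μY) :
    ((typedSupport (levelSupport P) n μX μY μZ).filter fun T' => T'.2.1 = J).card * (typeClass n μY).card =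
      (typedSupport (levelSupport P) n μX μY μZ).card := by
  rw [card_typedSupport_eq_mul_fibre₂ (levelSupport P) μX μY μZ hJ, mul_comm]

/-- **VXXZ Claim 5.6** (survival probability `≥ 3/4`, in counting form).  Let `𝒯` be the block
triples with marginal types `μX, μY, μZ`, `M` an odd prime with `P < M` and
`8 |𝒯| ≤ M · |typeClass n μX|`, `8 |𝒯| ≤ M · |typeClass n μY|` (the requirement
`M ≥ M₀ ≥ 8 max{numtriple/numxblock, numtriple/numyblock}`).  Then for every `T ∈ 𝒯` and every
bucket `b`, at least `3/4` of the `M^n` seeds that put `T` into bucket `b` let it survive the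
asymmetric cleanup: `3 M^n ≤ 4 · #{ω | Survives 𝒯 ω T b}`. [cite: VassilevskaWilliamsXuXuZhou2024, Claim 5.6] -/
theorem vxxz2024_claim56 (hM : M ≠ 2) (hPM : P < M) (hn : 0 < n) {μX μY μZ : Fin (P + 1) → ℕ}
    (h8X : 8 * (typedSupport (levelSupport P) n μX μY μZ).card ≤ M * (typeClass n μX).card)
    (h8Y : 8 * (typedSupport (levelSupport P) n μX μY μZ).card ≤ M * (typeClass n μY).card)
    {T : (Fin n → Fin (P + 1)) × (Fin n → Fin (P + 1)) × (Fin n → Fin (P + 1))}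
    (hT : T ∈ typedSupport (levelSupport P) n μX μY μZ) (b : ZMod M) :
    3 * M ^ n ≤ 4 * (univ.filter fun ω : VxxzSeed M n =>
      Survives (typedSupport (levelSupport P) n μX μY μZ) ω T b).card := by
  classical
  set 𝒯 := typedSupport (levelSupport P) n μX μY μZ with h𝒯
  obtain ⟨hIμ, hJμ, -, -⟩ := mem_typedSupport.1 hT
  -- the seeds with `T` in bucket `b` split into survivors and the two kinds of collisions
  set S := univ.filter fun ω : VxxzSeed M n => Survives 𝒯 ω T b with hS
  set CX := univ.filter fun ω : VxxzSeed M n =>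
    InBucket P ω T b ∧ ∃ T' ∈ 𝒯, T' ≠ T ∧ T'.1 = T.1 ∧ InBucket P ω T' b with hCX
  set CY := univ.filter fun ω : VxxzSeed M n =>
    InBucket P ω T b ∧ ∃ T' ∈ 𝒯, T' ≠ T ∧ T'.2.1 = T.2.1 ∧ InBucket P ω T' b with hCY
  have hcover : (univ.filter fun ω : VxxzSeed M n => InBucket P ω T b) ⊆ S ∪ (CX ∪ CY) := by
    intro ω hω
    rw [mem_filter] at hω
    rw [mem_union, mem_union, hS, hCX, hCY, mem_filter, mem_filter, mem_filter]
    by_cases hx : ∃ T' ∈ 𝒯, T' ≠ T ∧ T'.1 = T.1 ∧ InBucket P ω T' b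
    · exact Or.inr (Or.inl ⟨mem_univ _, hω.2, hx⟩)
    by_cases hy : ∃ T' ∈ 𝒯, T' ≠ T ∧ T'.2.1 = T.2.1 ∧ InBucket P ω T' b
    · exact Or.inr (Or.inr ⟨mem_univ _, hω.2, hy⟩)
    refine Or.inl ⟨mem_univ _, hω.2, fun T' hT' hne h1 hb => hx ⟨T', hT', hne, h1, hb⟩,
      fun T' hT' hne h2 hb => hy ⟨T', hT', hne, h2, hb⟩⟩
  have hbucket : (univ.filter fun ω : VxxzSeed M n => InBucket P ω T b).card = M ^ n :=
    card_seeds_inBucket hM hT b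
  -- union bounds for the collisions
  have hCXle : CX.card ≤ ((𝒯.filter fun T' => T'.1 = T.1).card - 1) * M ^ (n - 1) := by
    have hsub : CX ⊆ ((𝒯.filter fun T' => T'.1 = T.1).erase T).biUnion fun T' =>
        univ.filter fun ω : VxxzSeed M n => InBucket P ω T b ∧ InBucket P ω T' b := by
      intro ω hω
      rw [hCX, mem_filter] at hω
      obtain ⟨-, hb, T', hT', hne, h1, hb'⟩ := hω
      rw [mem_biUnion]
      exact ⟨T', mem_erase.2 ⟨hne, mem_filter.2 ⟨hT', h1⟩⟩, mem_filter.2 ⟨mem_univ _, hb, hb'⟩⟩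
    refine (card_le_card hsub).trans (card_biUnion_le.trans ?_)
    have hTmem : T ∈ 𝒯.filter (fun T' => T'.1 = T.1) := mem_filter.2 ⟨hT, rfl⟩
    rw [← card_erase_of_mem hTmem, ← smul_eq_mul, ← sum_const]
    refine sum_le_sum fun T' hT' => ?_
    obtain ⟨hne, hT'⟩ := mem_erase.1 hT'
    obtain ⟨hT'𝒯, h1⟩ := mem_filter.1 hT'
    exact (card_seeds_inBucket_shareX hM hPM hn hT hT'𝒯 hne h1 b).le
  have hCYle : CY.card ≤ ((𝒯.filter fun T' => T'.2.1 = T.2.1).card - 1) * M ^ (n - 1) := by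
    have hsub : CY ⊆ ((𝒯.filter fun T' => T'.2.1 = T.2.1).erase T).biUnion fun T' =>
        univ.filter fun ω : VxxzSeed M n => InBucket P ω T b ∧ InBucket P ω T' b := by
      intro ω hω
      rw [hCY, mem_filter] at hω
      obtain ⟨-, hb, T', hT', hne, h2, hb'⟩ := hω
      rw [mem_biUnion]
      exact ⟨T', mem_erase.2 ⟨hne, mem_filter.2 ⟨hT', h2⟩⟩, mem_filter.2 ⟨mem_univ _, hb, hb'⟩⟩
    refine (card_le_card hsub).trans (card_biUnion_le.trans ?_)
    have hTmem : T ∈ 𝒯.filter (fun T' => T'.2.1 = T.2.1) := mem_filter.2 ⟨hT, rfl⟩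
    rw [← card_erase_of_mem hTmem, ← smul_eq_mul, ← sum_const]
    refine sum_le_sum fun T' hT' => ?_
    obtain ⟨hne, hT'⟩ := mem_erase.1 hT'
    obtain ⟨hT'𝒯, h2⟩ := mem_filter.1 hT'
    exact (card_seeds_inBucket_shareY hM hPM hn hT hT'𝒯 hne h2 b).le
  -- the degrees are `numtriple/numxblock ≤ M/8`
  have hdegX : 8 * (𝒯.filter fun T' => T'.1 = T.1).card ≤ M := by
    have hpos : 0 < (typeClass n μX).card := card_pos.2 ⟨T.1, mem_typeClass.2 hIμ⟩
    refine Nat.le_of_mul_le_mul_right ?_ hpos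
    calc 8 * (𝒯.filter fun T' => T'.1 = T.1).card * (typeClass n μX).card = 8 * 𝒯.card := by
          rw [mul_assoc, degX_mul_card_typeClass hIμ]
      _ ≤ M * (typeClass n μX).card := h8X
  have hdegY : 8 * (𝒯.filter fun T' => T'.2.1 = T.2.1).card ≤ M := by
    have hpos : 0 < (typeClass n μY).card := card_pos.2 ⟨T.2.1, mem_typeClass.2 hJμ⟩
    refine Nat.le_of_mul_le_mul_right ?_ hpos
    calc 8 * (𝒯.filter fun T' => T'.2.1 = T.2.1).card * (typeClass n μY).card = 8 * 𝒯.card := by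
          rw [mul_assoc, degY_mul_card_typeClass hJμ]
      _ ≤ M * (typeClass n μY).card := h8Y
  have hpow : M ^ (n - 1) * M = M ^ n := by
    rw [← pow_succ]; congr 1; omega
  have hCX8 : 8 * CX.card ≤ M ^ n := by
    calc 8 * CX.card ≤ 8 * (((𝒯.filter fun T' => T'.1 = T.1).card - 1) * M ^ (n - 1)) :=
          Nat.mul_le_mul_left _ hCXle
      _ ≤ 8 * ((𝒯.filter fun T' => T'.1 = T.1).card * M ^ (n - 1)) :=
          Nat.mul_le_mul_left _ (Nat.mul_le_mul_right _ (Nat.sub_le _ _))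
      _ = 8 * (𝒯.filter fun T' => T'.1 = T.1).card * M ^ (n - 1) := by ring
      _ ≤ M * M ^ (n - 1) := Nat.mul_le_mul_right _ hdegX
      _ = M ^ n := by rw [mul_comm, hpow]
  have hCY8 : 8 * CY.card ≤ M ^ n := by
    calc 8 * CY.card ≤ 8 * (((𝒯.filter fun T' => T'.2.1 = T.2.1).card - 1) * M ^ (n - 1)) :=
          Nat.mul_le_mul_left _ hCYle
      _ ≤ 8 * ((𝒯.filter fun T' => T'.2.1 = T.2.1).card * M ^ (n - 1)) :=
          Nat.mul_le_mul_left _ (Nat.mul_le_mul_right _ (Nat.sub_le _ _))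
      _ = 8 * (𝒯.filter fun T' => T'.2.1 = T.2.1).card * M ^ (n - 1) := by ring
      _ ≤ M * M ^ (n - 1) := Nat.mul_le_mul_right _ hdegY
      _ = M ^ n := by rw [mul_comm, hpow]
  -- assemble: `M^n ≤ |S| + |CX| + |CY|`
  have hle : M ^ n ≤ S.card + (CX.card + CY.card) := by
    rw [← hbucket]
    exact (card_le_card hcover).trans ((card_union_le _ _).trans
      (Nat.add_le_add_left (card_union_le _ _) _))
  omega

/-- **VXXZ Claim 5.7** (expected number of surviving triples, in counting form): summing Claim 5.6
over the triples of any `𝒯α ⊆ 𝒯` (those consistent with `α`) and the buckets `b ∈ B`,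
`3 · |B| · |𝒯α| · M^n ≤ 4 · ∑_ω #{(b, T) ∈ B × 𝒯α | Survives 𝒯 ω T b}` — dividing by `|Ω| = M^{n+2}`,
the expected number of `(b, T)` with `T ∈ 𝒯α` surviving in bucket `b ∈ B` is `≥ (3/4) |B| |𝒯α| / M²`
(`= numalpha · |B| · (3/4) · M^{-2}`). [cite: VassilevskaWilliamsXuXuZhou2024, Claim 5.7] -/
theorem vxxz2024_claim57 (hM : M ≠ 2) (hPM : P < M) (hn : 0 < n) {μX μY μZ : Fin (P + 1) → ℕ}
    (h8X : 8 * (typedSupport (levelSupport P) n μX μY μZ).card ≤ M * (typeClass n μX).card)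
    (h8Y : 8 * (typedSupport (levelSupport P) n μX μY μZ).card ≤ M * (typeClass n μY).card)
    {𝒯α : Finset ((Fin n → Fin (P + 1)) × (Fin n → Fin (P + 1)) × (Fin n → Fin (P + 1)))}
    (h𝒯α : 𝒯α ⊆ typedSupport (levelSupport P) n μX μY μZ) (B : Finset (ZMod M)) :
    3 * (B.card * 𝒯α.card * M ^ n) ≤ 4 * ∑ ω : VxxzSeed M n,
      ((B ×ˢ 𝒯α).filter fun bT => Survives (typedSupport (levelSupport P) n μX μY μZ) ω bT.2 bT.1).card := by
  classical
  -- exchange the order of summation: sum over `(b, T)` of the number of good seeds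
  have hswap : ∑ ω : VxxzSeed M n,
      ((B ×ˢ 𝒯α).filter fun bT => Survives (typedSupport (levelSupport P) n μX μY μZ) ω bT.2 bT.1).card =
      ∑ bT ∈ B ×ˢ 𝒯α, (univ.filter fun ω : VxxzSeed M n =>
        Survives (typedSupport (levelSupport P) n μX μY μZ) ω bT.2 bT.1).card := by
    simp only [card_filter]
    rw [sum_comm]
  rw [hswap, mul_sum]
  calc 3 * (B.card * 𝒯α.card * M ^ n) = ∑ _bT ∈ B ×ˢ 𝒯α, 3 * M ^ n := by
        rw [sum_const, card_product, smul_eq_mul]; ring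
    _ ≤ ∑ bT ∈ B ×ˢ 𝒯α, 4 * (univ.filter fun ω : VxxzSeed M n =>
          Survives (typedSupport (levelSupport P) n μX μY μZ) ω bT.2 bT.1).card :=
        sum_le_sum fun bT hbT => vxxz2024_claim56 hM hPM hn h8X h8Y (h𝒯α (mem_product.1 hbT).2) bT.1

/-- **Claim 5.7, existence of a good seed**: some choice of the hash functions lets at least the
expected number of triples of `𝒯α` survive in the buckets of `B`:
`∃ ω, 3 |B| |𝒯α| ≤ 4 M² · #{T ∈ 𝒯α | T survives in some bucket b ∈ B}`.
[cite: VassilevskaWilliamsXuXuZhou2024, Claim 5.7] -/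
theorem vxxz2024_claim57_exists (hM : M ≠ 2) (hPM : P < M) (hn : 0 < n) {μX μY μZ : Fin (P + 1) → ℕ}
    (h8X : 8 * (typedSupport (levelSupport P) n μX μY μZ).card ≤ M * (typeClass n μX).card)
    (h8Y : 8 * (typedSupport (levelSupport P) n μX μY μZ).card ≤ M * (typeClass n μY).card)
    {𝒯α : Finset ((Fin n → Fin (P + 1)) × (Fin n → Fin (P + 1)) × (Fin n → Fin (P + 1)))}
    (h𝒯α : 𝒯α ⊆ typedSupport (levelSupport P) n μX μY μZ) (B : Finset (ZMod M)) :
    ∃ ω : VxxzSeed M n, 3 * (B.card * 𝒯α.card) ≤ 4 * M ^ 2 *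
      (𝒯α.filter fun T => ∃ b ∈ B, Survives (typedSupport (levelSupport P) n μX μY μZ) ω T b).card := by
  classical
  have hsum := vxxz2024_claim57 hM hPM hn h8X h8Y h𝒯α B
  simp only [card_filter_product_survives_eq] at hsum
  -- averaging over the `M^{n+2}` seeds
  by_contra hcon
  simp only [not_exists, not_le] at hcon
  have hlt : ∑ ω : VxxzSeed M n, 4 * M ^ 2 *
      (𝒯α.filter fun T => ∃ b ∈ B, Survives (typedSupport (levelSupport P) n μX μY μZ) ω T b).card <
      ∑ _ω : VxxzSeed M n, 3 * (B.card * 𝒯α.card) :=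
    sum_lt_sum_of_nonempty univ_nonempty fun ω _ => hcon ω
  rw [sum_const, card_univ, card_vxxzSeed, smul_eq_mul, ← mul_sum] at hlt
  have : M ^ (n + 2) * (3 * (B.card * 𝒯α.card)) ≤ 4 * M ^ 2 *
      ∑ ω : VxxzSeed M n, (𝒯α.filter fun T => ∃ b ∈ B, Survives (typedSupport (levelSupport P) n μX μY μZ) ω T b).card := by
    calc M ^ (n + 2) * (3 * (B.card * 𝒯α.card)) = M ^ 2 * (3 * (B.card * 𝒯α.card * M ^ n)) := by ring
      _ ≤ M ^ 2 * (4 * ∑ ω : VxxzSeed M n,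
          (𝒯α.filter fun T => ∃ b ∈ B, Survives (typedSupport (levelSupport P) n μX μY μZ) ω T b).card) :=
          Nat.mul_le_mul_left _ hsum
      _ = _ := by ring
  exact absurd (lt_of_le_of_lt this hlt) (lt_irrefl _)

end Survival

end Literature.Computability.AlgebraicComplexity
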